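import Mathlib
import Summits.ValiantsHypothesis.ValiantsHypothesis.Theorems.LacunarySymmetroidMatrixDescartesCensusDefs
import Summits.ValiantsHypothesis.ValiantsHypothesis.Theorems.LacunarySymmetroidMatrixDescartesStubDescartesCeiling
import Summits.ValiantsHypothesis.ValiantsHypothesis.Theorems.KPlusLogSqLawWeakLiftingTowerGraftRankOneGraft

/-!
# Tower graft line, stub S4e: the corner graft law (window form) from the size-doubling rung

By-name closer for the registered stub **S4e `stub_cornerOfSizeDoubling : TowerSizeDoubling → TowerGraftLawCornerW`** of the
line `Cruxes/WeakLifting/Lines/tower_graft.lean` (rev 6; crux `WeakLifting` = stmt-ValiantsHypothesis-19561, restricted sub-case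
`TowerWeakLifting`; line planner val-idea-24 g0, critic of record val-idea-crit-6 g0 (price 17:23:55Z, texts 17:25:05Z)).

`cornerOfSizeDoubling` is the line's `TowerSizeDoubling → TowerGraftLawCornerW` VERBATIM with the line defs `TowerSizeDoubling`,
`TowerGraftLawCornerW`, `IsTower` inlined (the tree's `PosRootLawOn` imported), so the line discharges the stub by `exact`.
Content: the SIZE-DOUBLING hypothesis (in the window `K ≤ m+1`, on `(m+1)`-towers: the class budget at size `m+1+m` is
`2^C·B + 2^{C·log₂²(m+1)}` whenever it is `B` at size `m+1`) feeds the tree's RANK-ONE GRAFT LAW IN CLASS FORM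
(`TowerGraft.card_posRoots_rankOneGraft_vec_le`, p652808: `#posroots ≤ 2B + B' + 1`) and gives the corner law with constant
`C + 3`; the edge formats `m = 1` (where `log₂ m = 0`) and `K = 0` are paid by the Descartes ceiling of the grafted
`(K+1)`-letter pencil (`stub_descartesCeiling`: `#posroots + 1 ≤ C(m+K, m)`, i.e. `≤ K ≤ 1` resp. `= 0`).  The tower hypothesis and
the gap `m·dₗ < D` are passed through / unused, exactly as in the class-form law.

Def-free; Mathlib + three tree files (route-independent).  HONEST FRAMING: a bookkeeping joint between two RESEARCH rungs of a
skeleton for a RESTRICTED sub-case — it makes «size-doubling (S4d) ⇒ corner law (S4b, window form)» a kernel fact and proves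
neither; nothing here bears on `WeakLifting`, Conjecture B / `KPlusLogSqLaw`, `MatrixDescartes` (18050) or `VP ≠ VNP`.
Seat: prover val-sym-lift-p3 g16, `--supports stmt-ValiantsHypothesis-19561`.
-/

-- `Summit.ValiantsHypothesis.ValiantsHypothesis.…` repeats a component by the D-0017 layout
-- (single-conjunct summit), which the `dupNamespace` linter flags; the name is mandated.
set_option linter.dupNamespace false

namespace Summit.ValiantsHypothesis.ValiantsHypothesis.Theorems.KPlusLogSqLaw.TowerGraft

open Finset Polynomial Matrix
open scoped BigOperators Polynomial
open Summit.ValiantsHypothesis.ValiantsHypothesis.Theorems.LacunarySymmetroidMatrixDescartes (PosRootLawOn)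

/-- the grafted pencil is a `(K+1)`-letter lacunary pencil (`Fin.snoc`). [folklore] -/
theorem graft_eq_snoc_pencil {m K : ℕ} (d : Fin K → ℕ) (D : ℕ) (S : Fin K → Matrix (Fin m) (Fin m) ℝ)
    (E : Matrix (Fin m) (Fin m) ℝ) :
    (∑ l, ((X : ℝ[X]) ^ d l) • (S l).map Polynomial.C) + (X : ℝ[X]) ^ D • E.map Polynomial.C =
      ∑ l : Fin (K + 1), ((X : ℝ[X]) ^ (Fin.snoc d D : Fin (K + 1) → ℕ) l) •
        ((Fin.snoc S E : Fin (K + 1) → Matrix (Fin m) (Fin m) ℝ) l).map Polynomial.C := by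
  rw [Fin.sum_univ_castSucc]
  simp

/-- Descartes ceiling of a one-letter graft: `#posroots + 1 ≤ C(m+K, m)`. [folklore] -/
theorem card_posRoots_graft_add_one_le_choose {m K : ℕ} (d : Fin K → ℕ) (D : ℕ) (S : Fin K → Matrix (Fin m) (Fin m) ℝ)
    (E : Matrix (Fin m) (Fin m) ℝ) :
    (((∑ l, ((X : ℝ[X]) ^ d l) • (S l).map Polynomial.C) + (X : ℝ[X]) ^ D • E.map Polynomial.C).det.roots.toFinset.filter
        (fun t => 0 < t)).card + 1 ≤ Nat.choose (m + K) m := by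
  have h := Summit.ValiantsHypothesis.ValiantsHypothesis.Theorems.LacunarySymmetroidMatrixDescartes.stub_descartesCeiling
    (K + 1) m (Nat.succ_pos K) (Fin.snoc d D) (Fin.snoc S E)
  rw [← graft_eq_snoc_pencil] at h
  simpa using h

/-- the arithmetic of the joint: `2B + (2^C B + 2^{C L²}) + 1 ≤ 2^{C+3} B + 2^{(C+3) L²}` for `L ≥ 1`. [folklore] -/
theorem corner_arith (C B L N : ℕ) (hL : 1 ≤ L) (hN : N ≤ 2 * B + (2 ^ C * B + 2 ^ (C * L ^ 2)) + 1) :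
    N ≤ 2 ^ (C + 3) * B + 2 ^ ((C + 3) * L ^ 2) := by
  have hA : 2 + 2 ^ C ≤ 2 ^ (C + 3) := by
    have h1 : 1 ≤ 2 ^ C := Nat.one_le_two_pow
    have h2 : 2 ^ (C + 3) = 2 ^ C * 8 := by rw [pow_add]; norm_num
    omega
  have hP : 2 ^ (C * L ^ 2) + 1 ≤ 2 ^ ((C + 3) * L ^ 2) := by
    have h1 : 1 ≤ 2 ^ (C * L ^ 2) := Nat.one_le_two_pow
    have h2 : 2 ^ (C * L ^ 2 + 1) ≤ 2 ^ ((C + 3) * L ^ 2) :=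
      Nat.pow_le_pow_right (by norm_num) (by nlinarith)
    have h3 : 2 ^ (C * L ^ 2 + 1) = 2 ^ (C * L ^ 2) * 2 := by rw [pow_succ]
    omega
  calc N ≤ 2 * B + (2 ^ C * B + 2 ^ (C * L ^ 2)) + 1 := hN
    _ = (2 + 2 ^ C) * B + (2 ^ (C * L ^ 2) + 1) := by ring
    _ ≤ 2 ^ (C + 3) * B + 2 ^ ((C + 3) * L ^ 2) := Nat.add_le_add (Nat.mul_le_mul_right B hA) hP

/-- **S4e `stub_cornerOfSizeDoubling` (the line's `TowerSizeDoubling → TowerGraftLawCornerW`, verbatim with the line defs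
`TowerSizeDoubling`, `TowerGraftLawCornerW`, `IsTower` inlined).**  Size-doubling in the window (`K ≤ m+1`, `(m+1)`-towers)
gives the corner graft law in the window (`K ≤ m`, `m`-towers) with constant `C + 3`: for `m ≥ 2` by the rank-one graft law in
class form (`2B + B' + 1` with `B' = 2^C B + 2^{C log₂² m}`, `log₂ m ≥ 1`), for `m = 1` and for `K = 0` by the Descartes ceiling of the
grafted `(K+1)`-letter pencil (`≤ K ≤ 1`, resp. `0`). [this work] -/
theorem cornerOfSizeDoubling :
    (∃ C : ℕ, ∀ (m K B : ℕ) (d : Fin K → ℕ), K ≤ m + 1 → (∀ l l' : Fin K, l < l' → (m + 1) * d l < d l') →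
      PosRootLawOn (m + 1) K B d → PosRootLawOn (m + 1 + m) K (2 ^ C * B + 2 ^ (C * Nat.log 2 (m + 1) ^ 2)) d) →
    (∃ C : ℕ, ∀ (m K B D : ℕ) (d : Fin K → ℕ), K ≤ m → (∀ l l' : Fin K, l < l' → m * d l < d l') →
      (∀ l, m * d l < D) → PosRootLawOn m K B d →
        ∀ (S : Fin K → Matrix (Fin m) (Fin m) ℝ) (i : Fin m), (∀ l, (S l).IsSymm) →
          ((Matrix.det ((∑ l, ((X : ℝ[X]) ^ d l) • (S l).map Polynomial.C) +
              (X : ℝ[X]) ^ D • (Matrix.vecMulVec (Pi.single i (1 : ℝ)) (Pi.single i (1 : ℝ))).map Polynomial.C)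
            ).roots.toFinset.filter (fun t => 0 < t)).card ≤ 2 ^ C * B + 2 ^ (C * Nat.log 2 m ^ 2)) := by
  rintro ⟨C₀, hC⟩
  refine ⟨C₀ + 3, fun m K B D d hKm hd _hD hB S i hS => ?_⟩
  -- Descartes ceiling of the grafted `(K+1)`-letter pencil: `count + 1 ≤ C(m+K, m)`
  have hdesc := card_posRoots_graft_add_one_le_choose d D S (Matrix.vecMulVec (Pi.single i (1 : ℝ)) (Pi.single i (1 : ℝ)))
  have hRHS : 1 ≤ 2 ^ (C₀ + 3) * B + 2 ^ ((C₀ + 3) * Nat.log 2 m ^ 2) := le_add_left Nat.one_le_two_pow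
  rcases m with _ | m'
  · exact i.elim0
  rcases m' with _ | m''
  · -- `m = 1`: `count ≤ K ≤ 1`
    have hK1 : K ≤ 1 := hKm
    have h1 : Nat.choose (0 + 1 + K) (0 + 1) = K + 1 := by
      rw [show 0 + 1 + K = K + 1 from by ring]
      exact Nat.choose_one_right (K + 1)
    omega
  -- `m = m'' + 2 ≥ 2`
  rcases Nat.eq_zero_or_pos K with hK0 | hK
  · -- `K = 0`: `count + 1 ≤ C(m, m) = 1`
    subst hK0
    have h1 : Nat.choose (m'' + 1 + 1 + 0) (m'' + 1 + 1) = 1 := by simp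
    omega
  -- generic case: the rank-one graft law in class form with the doubled budget from size-doubling
  have hB' := hC (m'' + 1) K B d hKm hd hB
  have hfar : (X : ℝ[X]) ^ D • (Matrix.vecMulVec (Pi.single i (1 : ℝ)) (Pi.single i (1 : ℝ))).map Polynomial.C =
      ((X : ℝ[X]) ^ D * C 1) • (Matrix.vecMulVec (Pi.single i (1 : ℝ)) (Pi.single i (1 : ℝ))).map Polynomial.C := by
    rw [C_1, mul_one]
  rw [hfar]
  have h := card_posRoots_rankOneGraft_vec_le (m := m'' + 1) hK d D 1 (Pi.single i (1 : ℝ)) hB hB' S hS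
  have hL : 1 ≤ Nat.log 2 (m'' + 1 + 1) := Nat.succ_le_of_lt (Nat.log_pos (by norm_num) (by omega))
  exact corner_arith C₀ B (Nat.log 2 (m'' + 1 + 1)) _ hL h

end Summit.ValiantsHypothesis.ValiantsHypothesis.Theorems.KPlusLogSqLaw.TowerGraft
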